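import Summits.QuantumFields.BalabanUV.Beta.GAN24.InsertionChainVolumeLimit
import Summits.QuantumFields.BalabanUV.Beta.GAN24.EffectiveFormMixedInsertionLaw

/-!
# `BalabanUV.Beta.GAN24.MixedInsertionVolumeLimit` — binder row G-an2-4 ∕ (CONV-C), route R7 «TWO CURRENCIES», PART 158: THE MIXED INSERTION TOWER
# `c_{k,st} = L^{dk}Q_k(𝒢P(V₁)𝒢P(V₂)𝒢)Q_kᴴ` (PART 123's object, two Lipschitz backgrounds) HAS (UD)+(SR) VOLUME-FREE AND EL₂ MODULO THE BACKGROUNDS' POINTWISE LIMITS, AND THE PIECE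
# `c_k⁻¹c_{k,st}c_k⁻¹` OF THE MIXED SECOND u-DERIVATIVE `V_{bb′}` HAS THE β-CELL's WHOLE `LimitRate` END ON `ℤ^d`.  With PART 157 (`Σ̈_k`, the mixed quintic) this puts EVERY piece of
# PART 121 ∕ 123's mixed second derivative `∂_s∂_tΣ_k|₀ = c⁻¹ċ_sc⁻¹ċ_tc⁻¹ + c⁻¹ċ_tc⁻¹ċ_sc⁻¹ − c⁻¹(c_{st} + c_{ts})c⁻¹` of the first-order model's effective form in the β-cell's currency on
# `ℤ^d`.  Assembly: the decay half is PART 126's dictionary (`hdecB_of_conjBound`) on the conjugated bound `‖c(Δ_a⁻¹P₁Δ_a⁻¹P₂Δ_a⁻¹)‖ ≤ γ_w⁻¹κ_c²` (NE2's `WCoercive` letters + PART 124's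
# `hPc_firstOrder`), the rate half is PART 119's `towerLimitRate_mixedInsertion` on Bałaban's tower, joined by `decayRate_of_towerLimitRate`; EL₂ is PART 156's fine argument with two
# backgrounds; the END is PART 143's insertion socket (unit b2b-balaban-gan24-p3, gen 55; v1)

NOT IN PRINT; OUR PROOF ([folklore] bookkeeping BY NAME over PART 126 (`hdecB_of_conjBound`), PART 124 (`hPc_firstOrder`, `exists_admissible_rate`), PART 119 (`towerLimitRate_mixedInsertion`),
NE2's `freeTowerLaws_balaban`, `perturbationLaws_firstOrder`, `wCoercive_calDa_of_conjDefect`, `conjDefect_calDalev_rho`, `opNorm_conjMat_inv_le_of_wCoercive`, `conjMat_mul_same`,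
`DecayRateInterpolation.decayRate_of_towerLimitRate`, PART 128 ∕ 130 (rate monotonicity, `entryDecay_add`), PART 151 (`tendsto_Pmodel_mul_pair`, `norm_Pmodel_mul_apply_le`,
`tendsto_avgTow_pair_of_fine`), PART 146 ∕ 145 ∕ 144 (fine decay, bounds, pair products), PART 143 (`conv_insertion_invCov_of_kernel`); [Balaban1987RG1] (1.21)–(1.22) p. 264 LOCATE the shapes).
HONEST FRAMING (cell contract, verbatim): «discharging `BetaPertH` makes Bałaban's UV stability UNCONDITIONAL — a real constructive-QFT result; it is NOT the
continuum limit and NOT the Clay problem.»  HONEST DEPENDENCY (verbatim): «continuum YM on T⁴ ⇐ BetaPertH ∧ nine spine estimates (0/9 proved); BetaPertH ⇐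
(D1) ∧ (D4) ∧ CAP+tail; G-an2-4 gates asym, D1 and NE2/3/4.»

WHAT THIS FILE PROVES (0 sorry, 0 `def`; `c_{k,st}` as above, `κ_c = d·α·G2(…)` at an admissible fine rate, `e = unitIdx⁻¹`):
* §1 `mixed_eq`, `opNorm_conjMat_mixed_le` (`‖c(Δ_a⁻¹P₁Δ_a⁻¹P₂Δ_a⁻¹)‖ ≤ γ_w⁻¹κ_c²`), **`mixedInsertion_decay_inputs`** (`L ≥ 2`, `d ≥ 1`: `∃ κ > 0, B, B′ ≥ 0` from `(d, L, a, α, β)` with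
  (UD)+(SR) (`θ = √(L⁻¹)`) of `c_{k,st}` for EVERY torus and EVERY pair of Lipschitz backgrounds with common `(α, β)`).
* §2 **`tendsto_mixed_fine_pair`** (`d ≥ 3`, even cubic volumes: EL₂ of `𝒢·(P₁𝒢)(P₂𝒢)` at fine integer pairs modulo EL₁ of `V₁,t`, `V₂,t`), **`tendsto_mixed_pair`** (EL₂ of `c_{k,st}` at unit pairs).
* §3 **`conv_mixedInsertion_of_tendsto_background`** — `d ≥ 3`, `L ≥ 2`, `a > 0`, `μ ≠ ν`, even cubic volumes: for two volume-indexed Lipschitz families (common `(α, β)`) DISPLAYING ONLY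
  their EL₁, the tower `c_k⁻¹c_{k,st}c_k⁻¹` has `∃ κ′ > 0, B, B′ ≥ 0, Π`: `IsInfiniteVolumeLimit`, `UniformDecay`, `StepRate (√(L⁻¹))`, `KernelInputs`, `|secondMoment (Π k) − secondMoment Π_∞| ≤ c₀(√(L⁻¹))^k`.
WHAT IT DOES NOT DO: identify any of this with Bałaban's `Π⁰_{k+1}`; `U ≠ 1`; `d ≤ 2` ∕ odd volumes.  SUPPLIER work; NEVER «G-an2-4 closed»; NOT (CONV-C), NOT D1, NOT `BetaPertH`,
NOT continuum, NOT Clay.  Records: `HOME/b2b-balaban-gan24-p3/gen55/README.md`.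
-/

noncomputable section

open scoped BigOperators ComplexConjugate Matrix Matrix.Norms.L2Operator
open Filter Topology

namespace Summit.QuantumFields.BalabanUV.Beta.GAN24.MixedInsertionVolumeLimit

open Literature.MathematicalPhysics.QuantumFieldTheory.Balaban1983to89
open Literature.MathematicalPhysics.QuantumFieldTheory.Balaban1983to89.B5Prop11Plancherel (Tor fine Cst Cst_nonneg)
open Literature.MathematicalPhysics.QuantumFieldTheory.Balaban1983to89.B5G183RateUnitTower (lev)
open Literature.MathematicalPhysics.QuantumFieldTheory.Balaban1983to89.B12Sec2to5 (l1 betaPrime510)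
open Literature.MathematicalPhysics.QuantumFieldTheory.Balaban1983to89.Beta (Site windowMap IsInfiniteVolumeLimit)
open Literature.MathematicalPhysics.QuantumFieldTheory.Balaban1983to89.Beta.FreeLegDictionary (cubic)
open Literature.MathematicalPhysics.QuantumFieldTheory.Balaban1983to89.Beta.BlockKernelVolumeSockets (evenPeriod tendsto_evenPeriod)
open Literature.MathematicalPhysics.QuantumFieldTheory.Balaban1983to89.Beta.VectorTails (castT)
open Literature.MathematicalPhysics.QuantumFieldTheory.Balaban1983to89.Beta.LimitRate (StepRate limKernelOf KernelInputs)
open Summit.QuantumFields.BalabanUV.T4Continuum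
open Summit.QuantumFields.BalabanUV.T4Continuum.CovariantAveragingTower (avgTow)
open Summit.QuantumFields.BalabanUV.T4Continuum.BalabanAveragedTowerUnit (idx QBlev calGlev unitCovB one_le_lev')
open Summit.QuantumFields.BalabanUV.T4Continuum.BalabanAveragedCoerciveTower (unitIdx)
open Summit.QuantumFields.BalabanUV.T4Continuum.BalabanAveragingPairing (freeTowerLaws_balaban)
open Summit.QuantumFields.BalabanUV.T4Continuum.KingPairingPlantedLaw (calDalev calDalev_inv CJ CJ_nonneg)
open Summit.QuantumFields.BalabanUV.T4Continuum.FirstOrderBackgroundModel (LipschitzBackground Pmodel C2model perturbationLaws_firstOrder)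
open Summit.QuantumFields.BalabanUV.T4Continuum.CTWeightedCoercivity (conjMat WCoercive)
open Summit.QuantumFields.BalabanUV.T4Continuum.CTAveragedTowerDecay (opNorm_conjMat_inv_le_of_wCoercive conjMat_mul_same)
open Summit.QuantumFields.BalabanUV.T4Continuum.CTKingTowerWeights (rho distK)
open Summit.QuantumFields.BalabanUV.T4Continuum.CTConjugatedHbd (G2 G2_nonneg wCoercive_calDa_of_conjDefect)
open Summit.QuantumFields.BalabanUV.T4Continuum.CTConjDefectDischarge (conjDefect_calDalev_rho max_JA_lt_gamD)
open Summit.QuantumFields.BalabanUV.T4Continuum.DirichletRegionTower (gamD)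
open Summit.QuantumFields.BalabanUV.T4Continuum.CTVectorPropagator (JA)
open Summit.QuantumFields.BalabanUV.T4Continuum.DecayRateInterpolation (EntryDecay DecayRate TwoLevelDecayRate decayRate_of_towerLimitRate)
open Summit.QuantumFields.BalabanUV.Beta.GAN24.DiagramDecayAlgebra (entryDecay_add)
open Summit.QuantumFields.BalabanUV.Beta.GAN24.UnitLatticeDecayAlgebra (distK_nonneg)
open Summit.QuantumFields.BalabanUV.Beta.GAN24.EffectiveFormDecay (entryDecay_of_le_rate)
open Summit.QuantumFields.BalabanUV.Beta.GAN24.InsertionChainDecay (hPc_firstOrder exists_admissible_rate)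
open Summit.QuantumFields.BalabanUV.Beta.GAN24.InsertionChainDecayBalaban (hdecB_of_conjBound)
open Summit.QuantumFields.BalabanUV.Beta.GAN24.InsertionChainLawMixed (towerLimitRate_mixedInsertion)
open Summit.QuantumFields.BalabanUV.Beta.GAN24.DiagramVolumeLimitPairs (l1_windowMap_neg)
open Summit.QuantumFields.BalabanUV.Beta.GAN24.DiagramVolumeLimitSandwich (conv_insertion_invCov_of_kernel)
open Summit.QuantumFields.BalabanUV.Beta.GAN24.VolumeLimitPairsFibre (tendsto_mul_pair')
open Summit.QuantumFields.BalabanUV.Beta.GAN24.FinePropagatorDecay (exists_fineWindowDecay_calGlev)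
open Summit.QuantumFields.BalabanUV.Beta.GAN24.FineInsertionVolumeLimit (norm_mul_apply_le_of_window tendsto_calGlev_pair)
open Summit.QuantumFields.BalabanUV.Beta.GAN24.PerturbedPropagatorVolumeLimit (tendsto_Pmodel_mul_pair norm_Pmodel_mul_apply_le tendsto_avgTow_pair_of_fine)

variable {d : ℕ} (L : ℕ) [NeZero L] (a : ℝ) (ha : 0 < a)

/-! ## §1 (UD)+(SR) of the mixed insertion tower, volume-free -/

section Decay

variable (M : Fin d → ℕ) [hM : ∀ μ, NeZero (M μ)]

/-- `Δ_a⁻¹P₁Δ_a⁻¹P₂Δ_a⁻¹ = 𝒢P₁𝒢P₂𝒢 = 𝒢·((P₁𝒢)(P₂𝒢))`. [folklore] -/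
theorem mixed_eq (k : ℕ) (P₁ P₂ : Matrix (idx L M k) (idx L M k) ℂ) :
    (calDalev L M a ha k)⁻¹ * P₁ * (calDalev L M a ha k)⁻¹ * P₂ * (calDalev L M a ha k)⁻¹ = calGlev L M a ha k * ((P₁ * calGlev L M a ha k) * (P₂ * calGlev L M a ha k)) := by
  rw [calDalev_inv]
  simp only [Matrix.mul_assoc]

/-- **the conjugated bound of the mixed chain**: `WCoercive Δ_a κ ρ γ_w`, `‖c(P_i)c(Δ_a⁻¹)‖ ≤ κ_c` ⟹ `‖c(Δ_a⁻¹P₁Δ_a⁻¹P₂Δ_a⁻¹)‖ ≤ γ_w⁻¹·κ_c·κ_c` (`conjMat` is multiplicative at equal weights).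
[folklore] -/
theorem opNorm_conjMat_mixed_le {k : ℕ} {κ : ℝ} {ρ : idx L M k → ℝ} {γw κc : ℝ} {P₁ P₂ : Matrix (idx L M k) (idx L M k) ℂ}
    (hW : WCoercive (calDalev L M a ha k) κ ρ γw) (hγ : 0 < γw)
    (hP₁ : ‖conjMat κ ρ ρ P₁ * conjMat κ ρ ρ (calDalev L M a ha k)⁻¹‖ ≤ κc) (hP₂ : ‖conjMat κ ρ ρ P₂ * conjMat κ ρ ρ (calDalev L M a ha k)⁻¹‖ ≤ κc) :
    ‖conjMat κ ρ ρ ((calDalev L M a ha k)⁻¹ * P₁ * (calDalev L M a ha k)⁻¹ * P₂ * (calDalev L M a ha k)⁻¹)‖ ≤ γw⁻¹ * κc * κc := by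
  have hκc : 0 ≤ κc := (norm_nonneg _).trans hP₁
  have e : (calDalev L M a ha k)⁻¹ * P₁ * (calDalev L M a ha k)⁻¹ * P₂ * (calDalev L M a ha k)⁻¹
      = (calDalev L M a ha k)⁻¹ * ((P₁ * (calDalev L M a ha k)⁻¹) * (P₂ * (calDalev L M a ha k)⁻¹)) := by simp only [Matrix.mul_assoc]
  rw [e, conjMat_mul_same, conjMat_mul_same, conjMat_mul_same κ ρ P₁, conjMat_mul_same κ ρ P₂]
  have h0 := opNorm_conjMat_inv_le_of_wCoercive hW hγ
  calc _ ≤ ‖conjMat κ ρ ρ (calDalev L M a ha k)⁻¹‖ * ‖conjMat κ ρ ρ P₁ * conjMat κ ρ ρ (calDalev L M a ha k)⁻¹ * (conjMat κ ρ ρ P₂ * conjMat κ ρ ρ (calDalev L M a ha k)⁻¹)‖ :=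
        Matrix.l2_opNorm_mul _ _
    _ ≤ γw⁻¹ * (κc * κc) := mul_le_mul h0 ((Matrix.l2_opNorm_mul _ _).trans (mul_le_mul hP₁ hP₂ (norm_nonneg _) hκc)) (norm_nonneg _) (inv_nonneg.mpr hγ.le)
    _ = γw⁻¹ * κc * κc := by ring

end Decay

/-- **`mixedInsertion_decay_inputs` — (UD)+(SR) OF THE MIXED INSERTION TOWER, VOLUME-FREE** (`L ≥ 2`, `d ≥ 1`): `∃ κ > 0, B, B′ ≥ 0` from `(d, L, a, α, β)` such that for EVERY torus `M`
and EVERY two backgrounds with `LipschitzBackground L M V_i α β`: (UD) `EntryDecay distK (c_{k,st}) B κ` ∀ `k` and (SR) `TwoLevelDecayRate distK c_{·,st} B′ κ (√(L⁻¹))` — PART 119's tower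
rate on Bałaban's tower + PART 126's decay dictionary on §1's conjugated bound, joined by `decayRate_of_towerLimitRate`; (UD) = limit decay + the `DecayRate` clause at half the rate. -/
theorem mixedInsertion_decay_inputs (hL : 2 ≤ L) (hd : 1 ≤ d) (α β : ℝ) :
    ∃ κ B B' : ℝ, 0 < κ ∧ 0 ≤ B ∧ 0 ≤ B' ∧ ∀ (M : Fin d → ℕ) [∀ μ, NeZero (M μ)] (V₁ V₂ : (k : ℕ) → Fin d → (idx L M k → ℂ)),
      LipschitzBackground L M V₁ α β → LipschitzBackground L M V₂ α β →
      (∀ k, EntryDecay (distK L M) (avgTow (QBlev L M) ((L : ℝ) ^ d)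
        (fun k => calGlev L M a ha k * Pmodel L M V₁ k * calGlev L M a ha k * Pmodel L M V₂ k * calGlev L M a ha k) k) B κ) ∧
      TwoLevelDecayRate (distK L M) (avgTow (QBlev L M) ((L : ℝ) ^ d)
        (fun k => calGlev L M a ha k * Pmodel L M V₁ k * calGlev L M a ha k * Pmodel L M V₂ k * calGlev L M a ha k)) B' κ (Real.sqrt ((L : ℝ)⁻¹)) := by
  obtain ⟨κ, hκ0, -, hγ', hδ', hJA⟩ := exists_admissible_rate d a
  have hJγ : max (JA d a 1 κ 1) 0 < gamD d a := max_JA_lt_gamD a hJA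
  set J : ℝ := max (JA d a 1 κ 1) 0 with hJ
  set κc : ℝ := d * (α * G2 d a J (gamD d a - J) κ) with hκc
  set κ₀ : ℝ := d * (α + β) * Cst d a with hκ₀
  -- the decay constant and the rate constant
  set Bl : ℝ := (gamD d a - J)⁻¹ * κc * κc * Real.exp (κ * 4) with hBl
  set C : ℝ := (3 * κ₀ * κ₀ * CJ d a + κ₀ * C2model d L a α β + κ₀ * C2model d L a α β) + κ₀ * κ₀ * (2 * d * Cst d a + 2 * (d * L * Cst d a)) with hCdef
  set R : ℝ := Real.sqrt (2 * Bl * (C / (1 - (L : ℝ)⁻¹))) with hR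
  set R' : ℝ := Real.sqrt (2 * Bl * (2 * C / (1 - (L : ℝ)⁻¹))) with hR'
  have hL1 : (1 : ℝ) < L := by exact_mod_cast (lt_of_lt_of_le one_lt_two hL : 1 < L)
  have hρ0 : (0 : ℝ) ≤ (L : ℝ)⁻¹ := inv_nonneg.mpr (Nat.cast_nonneg _)
  have hρ1 : ((L : ℝ)⁻¹) < 1 := inv_lt_one_of_one_lt₀ hL1
  have hr : (0 : ℝ) < (L : ℝ) ^ d := pow_pos (lt_trans zero_lt_one hL1) d
  have hθ0 : 0 ≤ Real.sqrt ((L : ℝ)⁻¹) := Real.sqrt_nonneg _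
  have hθ1 : Real.sqrt ((L : ℝ)⁻¹) ≤ 1 := by rw [Real.sqrt_le_one]; exact inv_le_one_of_one_le₀ hL1.le
  refine ⟨κ / 2, max Bl 0 + R, R', half_pos hκ0, add_nonneg (le_max_right _ _) (Real.sqrt_nonneg _), Real.sqrt_nonneg _, fun M _ V₁ V₂ hV₁ hV₂ => ?_⟩
  have hαβ : 0 ≤ α ∧ 0 ≤ β := hV₁.nonneg
  have hκ₀0 : 0 ≤ κ₀ := by have := Cst_nonneg d a; have := hαβ.1; have := hαβ.2; positivity
  have hP₁ := perturbationLaws_firstOrder L M a ha hd hV₁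
  have hP₂ := perturbationLaws_firstOrder L M a ha hd hV₂
  -- the rate half (PART 119 on Bałaban's tower)
  have hT := towerLimitRate_mixedInsertion hr (freeTowerLaws_balaban L M a ha) hP₁ hP₂ (C₀ := 2 * d * Cst d a) (C₁ := CJ d a)
    (C₂₁ := C2model d L a α β) (C₂₂ := C2model d L a α β) (Cf := d * L * Cst d a) hρ1
    (fun k => le_rfl) (fun k => le_rfl) (fun k => le_rfl) (fun k => le_rfl) (fun k => le_rfl)
  have hC0 : 0 ≤ (3 * κ₀ * κ₀ * CJ d a + κ₀ * C2model d L a α β + κ₀ * C2model d L a α β) + κ₀ * κ₀ * (2 * d * Cst d a + 2 * (d * L * Cst d a)) := by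
    have h1 := CJ_nonneg d a
    have h2 := Cst_nonneg d a
    have h3 : 0 ≤ C2model d L a α β := by unfold C2model; have := hαβ.1; have := hαβ.2; positivity
    positivity
  -- the decay half (PART 126's dictionary on the conjugated bound)
  have hW : ∀ (k : ℕ) (y : idx L M 0), WCoercive (calDalev L M a ha k) κ (rho L M k y) (gamD d a - J) :=
    fun k y => wCoercive_calDa_of_conjDefect (lev L k) (one_le_lev' L k) M a ha (conjDefect_calDalev_rho L M a ha one_pos hγ' hδ' k y)
  have hPc : ∀ (W : (k : ℕ) → Fin d → (idx L M k → ℂ)), LipschitzBackground L M W α β → ∀ (k : ℕ) (y : idx L M 0),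
      ‖conjMat κ (rho L M k y) (rho L M k y) (Pmodel L M W k) * conjMat κ (rho L M k y) (rho L M k y) (calDalev L M a ha k)⁻¹‖ ≤ κc :=
    fun W hW' k y => hPc_firstOrder L M a ha hW' (le_max_right _ _) hJγ k y (conjDefect_calDalev_rho L M a ha one_pos hγ' hδ' k y)
  have hdec : ∀ k, EntryDecay (distK L M) (avgTow (QBlev L M) ((L : ℝ) ^ d)
      (fun k => (calDalev L M a ha k)⁻¹ * Pmodel L M V₁ k * (calDalev L M a ha k)⁻¹ * Pmodel L M V₂ k * (calDalev L M a ha k)⁻¹) k) Bl κ := by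
    intro k
    have h := hdecB_of_conjBound L M (X := fun k => (calDalev L M a ha k)⁻¹ * Pmodel L M V₁ k * (calDalev L M a ha k)⁻¹ * Pmodel L M V₂ k * (calDalev L M a ha k)⁻¹)
      hκ0.le (fun k y => opNorm_conjMat_mixed_le L a ha M (hW k y) (sub_pos.mpr hJγ) (hPc V₁ hV₁ k y) (hPc V₂ hV₂ k y)) k
    rw [hBl]
    exact h
  obtain ⟨clim, -, hlim, hrate, hstep⟩ := decayRate_of_towerLimitRate hρ0 hρ1 hC0 hT hdec
  -- rewrite the family to the `calGlev` form
  have e : (fun k => (calDalev L M a ha k)⁻¹ * Pmodel L M V₁ k * (calDalev L M a ha k)⁻¹ * Pmodel L M V₂ k * (calDalev L M a ha k)⁻¹)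
      = fun k => calGlev L M a ha k * Pmodel L M V₁ k * calGlev L M a ha k * Pmodel L M V₂ k * calGlev L M a ha k := by
    funext k; rw [calDalev_inv]
  rw [e] at hrate hstep
  refine ⟨fun k => ?_, fun k x y => (hstep k x y).trans (le_of_eq (by rw [hR']))⟩
  have hlim' : EntryDecay (distK L M) clim (max Bl 0) κ := fun x y => (hlim x y).trans (mul_le_mul_of_nonneg_right (le_max_left _ _) (Real.exp_pos _).le)
  have h1 : EntryDecay (distK L M) clim (max Bl 0) (κ / 2) := entryDecay_of_le_rate (distK_nonneg L M) hlim' (le_max_right _ _) (half_le_self hκ0.le)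
  have h2 : EntryDecay (distK L M) (avgTow (QBlev L M) ((L : ℝ) ^ d)
      (fun k => calGlev L M a ha k * Pmodel L M V₁ k * calGlev L M a ha k * Pmodel L M V₂ k * calGlev L M a ha k) k - clim) R (κ / 2) := by
    intro x y
    refine (hrate k x y).trans ?_
    rw [hR]
    exact mul_le_mul_of_nonneg_right (mul_le_of_le_one_right (Real.sqrt_nonneg _) (pow_le_one₀ hθ0 hθ1)) (Real.exp_pos _).le
  have e2 : avgTow (QBlev L M) ((L : ℝ) ^ d) (fun k => calGlev L M a ha k * Pmodel L M V₁ k * calGlev L M a ha k * Pmodel L M V₂ k * calGlev L M a ha k) k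
      = clim + (avgTow (QBlev L M) ((L : ℝ) ^ d) (fun k => calGlev L M a ha k * Pmodel L M V₁ k * calGlev L M a ha k * Pmodel L M V₂ k * calGlev L M a ha k) k - clim) := by
    abel
  rw [e2]
  exact entryDecay_add h1 h2

/-! ## §2 EL₂ of the mixed insertion tower, modulo the backgrounds' pointwise limits -/

/-- **`tendsto_mixed_fine_pair` — EL₂ OF THE FINE KERNEL `𝒢P₁𝒢P₂𝒢 = 𝒢·(P₁𝒢)(P₂𝒢)` AT FINE INTEGER PAIRS, MODULO EL₁ OF BOTH BACKGROUNDS** [our proof] (`d ≥ 3`, `a > 0`, level `k`,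
even cubic volumes; Lipschitz backgrounds with common `(α, β)`): PART 156's argument with two backgrounds. [cite: Balaban1987RG1, p.264 (after (1.21): the `T ↗ ℤ^d` limit)] -/
theorem tendsto_mixed_fine_pair (hd : 3 ≤ d) (k : ℕ) {α β : ℝ}
    {V₁ V₂ : (t : ℕ) → (k : ℕ) → Fin d → (idx L (cubic d (evenPeriod t)) k → ℂ)}
    (hV₁ : ∀ t, LipschitzBackground L (cubic d (evenPeriod t)) (V₁ t) α β) (hV₂ : ∀ t, LipschitzBackground L (cubic d (evenPeriod t)) (V₂ t) α β)
    (hV₁1 : ∀ (μ f : Fin d) (z : Fin d → ℤ), ∃ s : ℂ, Tendsto (fun t => V₁ t k μ (castT (cubic d (lev L k * evenPeriod t)) z, f)) atTop (𝓝 s))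
    (hV₂1 : ∀ (μ f : Fin d) (z : Fin d → ℤ), ∃ s : ℂ, Tendsto (fun t => V₂ t k μ (castT (cubic d (lev L k * evenPeriod t)) z, f)) atTop (𝓝 s))
    (f g : Fin d) (z z' : Fin d → ℤ) :
    ∃ s : ℂ, Tendsto (fun t => (calGlev L (cubic d (evenPeriod t)) a ha k * ((Pmodel L (cubic d (evenPeriod t)) (V₁ t) k * calGlev L (cubic d (evenPeriod t)) a ha k)
        * (Pmodel L (cubic d (evenPeriod t)) (V₂ t) k * calGlev L (cubic d (evenPeriod t)) a ha k)))
      (castT (cubic d (lev L k * evenPeriod t)) z, f) (castT (cubic d (lev L k * evenPeriod t)) z', g)) atTop (𝓝 s) := by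
  have hd1 : 1 ≤ d := le_trans (by norm_num) hd
  have hd0 : (0 : ℝ) < d := by exact_mod_cast lt_of_lt_of_le zero_lt_one hd1
  have hn : (0 : ℝ) < lev L k := by exact_mod_cast Nat.pos_of_ne_zero (NeZero.ne (lev L k))
  have hside : Tendsto (fun t => lev L k * evenPeriod t) atTop atTop :=
    Filter.Tendsto.const_mul_atTop' (Nat.pos_of_ne_zero (NeZero.ne (lev L k))) tendsto_evenPeriod |>.congr fun t => by ring
  have hα : 0 ≤ α := (hV₁ 0).nonneg.1
  obtain ⟨κ, C, hκ, hC, hdec⟩ := exists_fineWindowDecay_calGlev L a ha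
  have hδ : 0 < κ / (d * lev L k) := div_pos hκ (mul_pos hd0 hn)
  have hGr : ∀ t (w : Site d (lev L k * evenPeriod t)) (g : Fin d) (y : Site d (lev L k * evenPeriod t)) (h : Fin d),
      ‖calGlev L (cubic d (evenPeriod t)) a ha k (w, g) (y, h)‖ ≤ C * Real.exp (-(κ / (d * lev L k)) * l1 (windowMap d (lev L k * evenPeriod t) (w - y))) :=
    fun t w g y h => hdec (evenPeriod t) k w y g h
  have hGl : ∀ t (x : Site d (lev L k * evenPeriod t)) (f : Fin d) (w : Site d (lev L k * evenPeriod t)) (g : Fin d),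
      ‖calGlev L (cubic d (evenPeriod t)) a ha k (x, f) (w, g)‖ ≤ C * Real.exp (-(κ / (d * lev L k)) * l1 (windowMap d (lev L k * evenPeriod t) (w - x))) := by
    intro t x f w g
    have h := hdec (evenPeriod t) k x w f g
    rwa [show x - w = -(w - x) from (neg_sub w x).symm, l1_windowMap_neg] at h
  have hGel := fun f g w w' => tendsto_calGlev_pair L a ha hd k f g w w'
  set CX : ℝ := d * (α * lev L k * ((Real.exp (3 * (κ / (d * lev L k))) + 1) * C)) with hCX
  have hCX0 : 0 ≤ CX := by positivity
  -- the two factors `X_i = P_i𝒢`: decay (right-site form and left-site form), bound, EL₂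
  have hXdec : ∀ (W : (t : ℕ) → (k : ℕ) → Fin d → (idx L (cubic d (evenPeriod t)) k → ℂ)), (∀ t, LipschitzBackground L (cubic d (evenPeriod t)) (W t) α β) →
      ∀ t (w : Site d (lev L k * evenPeriod t)) (g : Fin d) (y : Site d (lev L k * evenPeriod t)) (h : Fin d),
      ‖(Pmodel L (cubic d (evenPeriod t)) (W t) k * calGlev L (cubic d (evenPeriod t)) a ha k) (w, g) (y, h)‖
        ≤ CX * Real.exp (-(κ / (d * lev L k)) * l1 (windowMap d (lev L k * evenPeriod t) (w - y))) :=
    fun W hW t w g y h => norm_Pmodel_mul_apply_le L (evenPeriod t) (hW t) k hC hδ.le (hGr t) w g y h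
  have hXdecl : ∀ (W : (t : ℕ) → (k : ℕ) → Fin d → (idx L (cubic d (evenPeriod t)) k → ℂ)), (∀ t, LipschitzBackground L (cubic d (evenPeriod t)) (W t) α β) →
      ∀ t (x : Site d (lev L k * evenPeriod t)) (f : Fin d) (w : Site d (lev L k * evenPeriod t)) (g : Fin d),
      ‖(Pmodel L (cubic d (evenPeriod t)) (W t) k * calGlev L (cubic d (evenPeriod t)) a ha k) (x, f) (w, g)‖
        ≤ CX * Real.exp (-(κ / (d * lev L k)) * l1 (windowMap d (lev L k * evenPeriod t) (w - x))) := by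
    intro W hW t x f w g
    have h := hXdec W hW t x f w g
    rwa [show x - w = -(w - x) from (neg_sub w x).symm, l1_windowMap_neg] at h
  have hXb : ∀ (W : (t : ℕ) → (k : ℕ) → Fin d → (idx L (cubic d (evenPeriod t)) k → ℂ)), (∀ t, LipschitzBackground L (cubic d (evenPeriod t)) (W t) α β) →
      ∀ t (w : Site d (lev L k * evenPeriod t)) (g : Fin d) (y : Site d (lev L k * evenPeriod t)) (h : Fin d),
      ‖(Pmodel L (cubic d (evenPeriod t)) (W t) k * calGlev L (cubic d (evenPeriod t)) a ha k) (w, g) (y, h)‖ ≤ CX := by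
    intro W hW t w g y h
    refine (hXdec W hW t w g y h).trans ?_
    have : Real.exp (-(κ / (d * lev L k)) * l1 (windowMap d (lev L k * evenPeriod t) (w - y))) ≤ 1 := by
      rw [Real.exp_le_one_iff, neg_mul, neg_nonpos]; exact mul_nonneg hδ.le (Finset.sum_nonneg fun i _ => abs_nonneg _)
    simpa using mul_le_mul_of_nonneg_left this hCX0
  have hX1el := tendsto_Pmodel_mul_pair L (side := evenPeriod) k V₁ hV₁1 (G := fun t => calGlev L (cubic d (evenPeriod t)) a ha k) hGel
  have hX2el := tendsto_Pmodel_mul_pair L (side := evenPeriod) k V₂ hV₂1 (G := fun t => calGlev L (cubic d (evenPeriod t)) a ha k) hGel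
  -- `(P₁𝒢)(P₂𝒢)`: EL₂ and the volume-free bound
  have hXXel := tendsto_mul_pair' (d := d) (F := Fin d) (side := fun t => lev L k * evenPeriod t) hside
    (X := fun t => Pmodel L (cubic d (evenPeriod t)) (V₁ t) k * calGlev L (cubic d (evenPeriod t)) a ha k)
    (Y := fun t => Pmodel L (cubic d (evenPeriod t)) (V₂ t) k * calGlev L (cubic d (evenPeriod t)) a ha k) (hXdecl V₁ hV₁) hδ (hXb V₂ hV₂) hX1el hX2el
  have hXXb : ∀ t (w : Site d (lev L k * evenPeriod t)) (g : Fin d) (y : Site d (lev L k * evenPeriod t)) (h : Fin d),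
      ‖((Pmodel L (cubic d (evenPeriod t)) (V₁ t) k * calGlev L (cubic d (evenPeriod t)) a ha k)
        * (Pmodel L (cubic d (evenPeriod t)) (V₂ t) k * calGlev L (cubic d (evenPeriod t)) a ha k)) (w, g) (y, h)‖
        ≤ CX * CX * (Fintype.card (Fin d) * ∑' y : Fin d → ℤ, Real.exp (-(κ / (d * lev L k)) * l1 y)) :=
    fun t w g y h => norm_mul_apply_le_of_window (lev L k * evenPeriod t) hδ hCX0 hCX0 (hXdecl V₁ hV₁ t) (hXb V₂ hV₂ t) w g y h
  exact tendsto_mul_pair' (d := d) (F := Fin d) (side := fun t => lev L k * evenPeriod t) hside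
    (X := fun t => calGlev L (cubic d (evenPeriod t)) a ha k)
    (Y := fun t => (Pmodel L (cubic d (evenPeriod t)) (V₁ t) k * calGlev L (cubic d (evenPeriod t)) a ha k)
      * (Pmodel L (cubic d (evenPeriod t)) (V₂ t) k * calGlev L (cubic d (evenPeriod t)) a ha k)) hGl hδ hXXb hGel hXXel f g z z'

/-- **`tendsto_mixed_pair` — EL₂ OF THE MIXED INSERTION TOWER `c_{k,st}` ON THE UNIT LATTICE, MODULO EL₁ OF BOTH BACKGROUNDS** [our proof] (`d ≥ 3`, even cubic volumes): PART 151's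
middle-free stencil on `tendsto_mixed_fine_pair`, read back through `mixed_eq`. [cite: Balaban1987RG1, p.264 (after (1.21): the `T ↗ ℤ^d` limit)] -/
theorem tendsto_mixed_pair (hd : 3 ≤ d) (k : ℕ) {α β : ℝ}
    {V₁ V₂ : (t : ℕ) → (k : ℕ) → Fin d → (idx L (cubic d (evenPeriod t)) k → ℂ)}
    (hV₁ : ∀ t, LipschitzBackground L (cubic d (evenPeriod t)) (V₁ t) α β) (hV₂ : ∀ t, LipschitzBackground L (cubic d (evenPeriod t)) (V₂ t) α β)
    (hV₁1 : ∀ (μ f : Fin d) (z : Fin d → ℤ), ∃ s : ℂ, Tendsto (fun t => V₁ t k μ (castT (cubic d (lev L k * evenPeriod t)) z, f)) atTop (𝓝 s))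
    (hV₂1 : ∀ (μ f : Fin d) (z : Fin d → ℤ), ∃ s : ℂ, Tendsto (fun t => V₂ t k μ (castT (cubic d (lev L k * evenPeriod t)) z, f)) atTop (𝓝 s))
    (μ ν : Fin d) (z z' : Fin d → ℤ) :
    ∃ s : ℂ, Tendsto (fun t => (avgTow (QBlev L (cubic d (evenPeriod t))) ((L : ℝ) ^ d)
        (fun k' => calGlev L (cubic d (evenPeriod t)) a ha k' * Pmodel L (cubic d (evenPeriod t)) (V₁ t) k' * calGlev L (cubic d (evenPeriod t)) a ha k'
          * Pmodel L (cubic d (evenPeriod t)) (V₂ t) k' * calGlev L (cubic d (evenPeriod t)) a ha k') k)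
      ((unitIdx L (cubic d (evenPeriod t))).symm (castT (cubic d (evenPeriod t)) z, μ)) ((unitIdx L (cubic d (evenPeriod t))).symm (castT (cubic d (evenPeriod t)) z', ν))) atTop (𝓝 s) := by
  have e : ∀ t (k' : ℕ), calGlev L (cubic d (evenPeriod t)) a ha k' * Pmodel L (cubic d (evenPeriod t)) (V₁ t) k' * calGlev L (cubic d (evenPeriod t)) a ha k'
        * Pmodel L (cubic d (evenPeriod t)) (V₂ t) k' * calGlev L (cubic d (evenPeriod t)) a ha k'
      = calGlev L (cubic d (evenPeriod t)) a ha k' * ((Pmodel L (cubic d (evenPeriod t)) (V₁ t) k' * calGlev L (cubic d (evenPeriod t)) a ha k')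
        * (Pmodel L (cubic d (evenPeriod t)) (V₂ t) k' * calGlev L (cubic d (evenPeriod t)) a ha k')) := fun t k' => by simp only [Matrix.mul_assoc]
  simp only [e]
  obtain ⟨s, hs⟩ := tendsto_avgTow_pair_of_fine L k
    (X := fun t k' => calGlev L (cubic d (evenPeriod t)) a ha k' * ((Pmodel L (cubic d (evenPeriod t)) (V₁ t) k' * calGlev L (cubic d (evenPeriod t)) a ha k')
      * (Pmodel L (cubic d (evenPeriod t)) (V₂ t) k' * calGlev L (cubic d (evenPeriod t)) a ha k')))
    (fun f g w w' => tendsto_mixed_fine_pair L a ha hd k hV₁ hV₂ hV₁1 hV₂1 f g w w') μ ν z z'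
  refine ⟨s, hs.congr fun t => ?_⟩
  simp only [Matrix.reindex_apply, Matrix.submatrix_apply]

/-! ## §3 THE END for `c_k⁻¹c_{k,st}c_k⁻¹` -/

/-- **`conv_mixedInsertion_of_tendsto_background` — THE PIECE `c_k⁻¹c_{k,st}c_k⁻¹` OF THE MIXED SECOND u-DERIVATIVE ON `ℤ^d`, MODULO ONLY THE BACKGROUNDS' POINTWISE LIMITS**
[our proof] (`d ≥ 3`, `L ≥ 2`, `a > 0`, `μ ≠ ν`, even cubic volumes `2(t+1)`): for two volume-indexed families of Lipschitz backgrounds with common `(α, β)` DISPLAYING ONLY their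
EL₁, the tower `c_k⁻¹·[L^{dk}Q_k(𝒢P(V₁,t)𝒢P(V₂,t)𝒢)Q_kᴴ]·c_k⁻¹` has `∃ κ > 0, B, B′ ≥ 0, Π` with `IsInfiniteVolumeLimit`, `UniformDecay Π μ ν B (κ∕d)`, `StepRate Π μ ν B′ (κ∕d) (√(L⁻¹))`,
`KernelInputs d Π`, `∀ k, |secondMoment (Π k) μ ν − secondMoment (limKernelOf Π) μ ν| ≤ β′_d(B′∕(1−√(L⁻¹)), κ∕d)·(√(L⁻¹))^k` — PART 143's insertion socket on §1 + §2.
[cite: Balaban1987RG1, (1.21)–(1.22) p.264 (shapes)] -/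
theorem conv_mixedInsertion_of_tendsto_background (hL : 2 ≤ L) (hd : 3 ≤ d) {μ ν : Fin d} (hne : μ ≠ ν) {α β : ℝ}
    {V₁ V₂ : (t : ℕ) → (k : ℕ) → Fin d → (idx L (cubic d (evenPeriod t)) k → ℂ)}
    (hV₁ : ∀ t, LipschitzBackground L (cubic d (evenPeriod t)) (V₁ t) α β) (hV₂ : ∀ t, LipschitzBackground L (cubic d (evenPeriod t)) (V₂ t) α β)
    (hV₁1 : ∀ k (μ f : Fin d) (z : Fin d → ℤ), ∃ s : ℂ, Tendsto (fun t => V₁ t k μ (castT (cubic d (lev L k * evenPeriod t)) z, f)) atTop (𝓝 s))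
    (hV₂1 : ∀ k (μ f : Fin d) (z : Fin d → ℤ), ∃ s : ℂ, Tendsto (fun t => V₂ t k μ (castT (cubic d (lev L k * evenPeriod t)) z, f)) atTop (𝓝 s)) :
    ∃ κ B B' : ℝ, 0 < κ ∧ 0 ≤ B ∧ 0 ≤ B' ∧ ∃ Pinf : ℕ → B12Beta.Kernel d,
      (∀ k, IsInfiniteVolumeLimit evenPeriod
        (fun t μ' ν' (z : Site d (evenPeriod t)) => (((unitCovB L (cubic d (evenPeriod t)) a ha k)⁻¹
            * avgTow (QBlev L (cubic d (evenPeriod t))) ((L : ℝ) ^ d)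
                (fun k' => calGlev L (cubic d (evenPeriod t)) a ha k' * Pmodel L (cubic d (evenPeriod t)) (V₁ t) k' * calGlev L (cubic d (evenPeriod t)) a ha k'
                  * Pmodel L (cubic d (evenPeriod t)) (V₂ t) k' * calGlev L (cubic d (evenPeriod t)) a ha k') k
            * (unitCovB L (cubic d (evenPeriod t)) a ha k)⁻¹)
          ((unitIdx L (cubic d (evenPeriod t))).symm (z, μ')) ((unitIdx L (cubic d (evenPeriod t))).symm (0, ν'))).re) (Pinf k)) ∧
      Beta.LimitRate.UniformDecay Pinf μ ν B (κ / d) ∧ StepRate Pinf μ ν B' (κ / d) (Real.sqrt ((L : ℝ)⁻¹)) ∧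
      (∃ K : KernelInputs d Pinf, K.θ = Real.sqrt ((L : ℝ)⁻¹) ∧ K.c₀ = betaPrime510 d (B' / (1 - Real.sqrt ((L : ℝ)⁻¹))) (κ / d) ∧ K.Pinf = limKernelOf Pinf ∧ K.μ = μ ∧ K.ν = ν) ∧
      (∀ k, |B12Beta.secondMoment (Pinf k) μ ν - B12Beta.secondMoment (limKernelOf Pinf) μ ν|
          ≤ betaPrime510 d (B' / (1 - Real.sqrt ((L : ℝ)⁻¹))) (κ / d) * Real.sqrt ((L : ℝ)⁻¹) ^ k) := by
  have hd1 : 1 ≤ d := le_trans (by norm_num) hd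
  obtain ⟨κ, B, B', hκ, hB, hB', h⟩ := mixedInsertion_decay_inputs L a ha hL hd1 α β
  exact conv_insertion_invCov_of_kernel L a ha hL hd hne
    (X := fun t k => avgTow (QBlev L (cubic d (evenPeriod t))) ((L : ℝ) ^ d)
      (fun k' => calGlev L (cubic d (evenPeriod t)) a ha k' * Pmodel L (cubic d (evenPeriod t)) (V₁ t) k' * calGlev L (cubic d (evenPeriod t)) a ha k'
        * Pmodel L (cubic d (evenPeriod t)) (V₂ t) k' * calGlev L (cubic d (evenPeriod t)) a ha k') k)
    hκ hB hB' (fun t k => (h (cubic d (evenPeriod t)) (V₁ t) (V₂ t) (hV₁ t) (hV₂ t)).1 k) (fun t => (h (cubic d (evenPeriod t)) (V₁ t) (V₂ t) (hV₁ t) (hV₂ t)).2)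
    (fun k μ' ν' z z' => tendsto_mixed_pair L a ha hd k hV₁ hV₂ (hV₁1 k) (hV₂1 k) μ' ν' z z')

end Summit.QuantumFields.BalabanUV.Beta.GAN24.MixedInsertionVolumeLimit

end
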